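import Summits.ResolutionOfSingularities.ResolutionOfSingularities.Theorems.FrobeniusLadderFRationalResolutionTraceIdealPrimary
import Literature.AlgebraicGeometry.Resolution.RegularLocalRingsUFD
import Mathlib.RingTheory.UniqueFactorizationDomain.GCDMonoid
import Mathlib.Tactic.LinearCombination
import HarnessLib

/-!
# Crux `FrobeniusLadder.FRationalResolution` (stmt-ResolutionOfSingularities-15317), line `redirect`,
# stub `stub_diagonalizableQuotientResolution` — DIVISORIAL IDEALS ARE PRINCIPAL ON THE REGULAR PUNCTURED SPECTRUM,
# so their trace ideals are `𝔪`-primary (completes `…TraceIdealPrimary`, p840068, for the class-group centre `𝔞_tot`)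

`…TraceIdealPrimary.exists_pow_maximalIdeal_le_traceIdeal` (p840068) gives `𝔪ⁿ ⊆ τ(I)` for a nonzero ideal `I` of a Noetherian local domain that is
PRINCIPAL at every non-maximal prime. For the nonzero DIVISORIAL ideals (inline v-ideals of `…DivisorialIdealsCharacteristic`, p839146:
`x ∈ I` as soon as `b x ∈ (c)` for every pair with `b I ⊆ (c)`) of a local domain with REGULAR punctured spectrum this hypothesis holds:

* `exists_eq_span_singleton_of_divisorial` — **in a UFD a finitely generated divisorial ideal is principal** (generated by the gcd `d` of its
  generators: `b I ⊆ (c) ⇒ c ∣ b·d`, so `d ∈ I` by divisoriality);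
* ★ `divisorial_map_of_isLocalization` — **divisoriality localises** (`A` a Noetherian domain): if `x' = x/u` passes the v-test for `I A_M` then,
  testing against the pairs `(y₀, φ(y₀))` for `φ` in a finite generating set of `Hom_A(I, A)`, one finds `v ∈ M` with `y₀ ∣ v·φ(y₀)·x` for ALL
  `φ`, whence `v x` passes the v-test for `I` (every test pair `(c, b)` IS such a `φ = b/c`), `v x ∈ I`, `x' ∈ I A_M`;
* ★★ `exists_pow_maximalIdeal_le_traceIdeal_of_divisorial` — `A` a Noetherian local domain with `A_𝔮` regular for `𝔮 ≠ 𝔪`, `I` nonzero divisorial: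
  **`𝔪ⁿ ⊆ τ(I)`** (Auslander–Buchsbaum `Matsumura1987_20_3_holds`: `A_𝔮` is a UFD); `exists_pow_maximalIdeal_le_prod_traceIdeal_of_divisorial` — the
  product over a finite family; `prod_traceIdeal_ne_top_of_not_principal` — and `∏ τ ≠ ⊤` as soon as one member is non-principal.

So of the inputs of `…IntrinsicRecipe.hloc_of_traceIdealCentre_then_singularPoints` (p839630) only the FINITE LIST of divisorial representatives
(`hfin`, (α′)) and the fan facts (β) remain. Honest label: general commutative algebra toward ONE leaf stub (no stub, crux or summit closed).
No definitions, no named facts, no sorry. [cite: Matsumura1987, Thm. 20.3; Thm. 19.3; §11] [cite: StacksProject, Tag 0AFW; Tag 00HP] [folklore]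
-/

-- single-problem summit: the doubled namespace component is forced
set_option linter.dupNamespace false

open IsLocalRing
open Literature.AlgebraicGeometry.Resolution

namespace Summit.ResolutionOfSingularities.ResolutionOfSingularities.Theorems.FRationalResolution.TraceIdealDivisorial

universe u

/-! ## §1 Functionals on an ideal commute with multiplication -/

/-- For `φ : I → A` linear and `a, b ∈ I`: `φ(a)·b = φ(b)·a` (both are `φ(ab)`). [folklore] -/
theorem apply_mul_comm {A : Type u} [CommRing A] {I : Ideal A} (φ : I →ₗ[A] A) (a b : I) :
    φ a * (b : A) = φ b * (a : A) := by
  have h1 : ((b : A) • a : I) = ((a : A) • b : I) := by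
    ext
    simp only [SetLike.val_smul, smul_eq_mul, mul_comm]
  rw [mul_comm, ← smul_eq_mul, ← map_smul, h1, map_smul, smul_eq_mul, mul_comm]

/-! ## §2 In a UFD, finitely generated divisorial ideals are principal -/

/-- gcd-fold of a list divides every member. [folklore] -/
theorem foldr_gcd_dvd {S : Type u} [CommRing S] [IsDomain S] [GCDMonoid S] (L : List S) :
    ∀ g ∈ L, L.foldr gcd 0 ∣ g := by
  induction L with
  | nil => intro g hg; simp at hg
  | cons a L ih =>
    intro g hg
    rw [List.foldr_cons]
    rcases List.mem_cons.mp hg with rfl | hg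
    · exact gcd_dvd_left _ _
    · exact (gcd_dvd_right _ _).trans (ih g hg)

/-- `c ∣ b·g` for every member `g` forces `c ∣ b · gcd`. [folklore] -/
theorem dvd_mul_foldr_gcd {S : Type u} [CommRing S] [IsDomain S] [GCDMonoid S] (L : List S) (b c : S)
    (h : ∀ g ∈ L, c ∣ b * g) : c ∣ b * L.foldr gcd 0 := by
  induction L with
  | nil => simp
  | cons a L ih =>
    rw [List.foldr_cons]
    have h1 : c ∣ gcd (b * a) (b * L.foldr gcd 0) :=
      dvd_gcd (h a (by simp)) (ih fun g hg => h g (List.mem_cons_of_mem a hg))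
    exact (gcd_mul_left' b a (L.foldr gcd 0)).dvd_iff_dvd_right.mp h1

/-- **In a UFD a finitely generated divisorial ideal is principal.** [cite: StacksProject, Tag 0AFW] [folklore] -/
theorem exists_eq_span_singleton_of_divisorial {S : Type u} [CommRing S] [IsDomain S] [UniqueFactorizationMonoid S]
    (J : Ideal S) (hJ : J.FG)
    (hdiv : ∀ x : S, (∀ c b : S, (∀ y ∈ J, b * y ∈ Ideal.span ({c} : Set S)) → b * x ∈ Ideal.span ({c} : Set S)) → x ∈ J) :
    ∃ d : S, J = Ideal.span {d} := by
  classical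
  letI : GCDMonoid S := UniqueFactorizationMonoid.toGCDMonoid S
  obtain ⟨G, hG⟩ := hJ
  set d : S := G.toList.foldr gcd 0 with hd
  have hdvd : ∀ g ∈ G, d ∣ g := fun g hg => foldr_gcd_dvd G.toList g (Finset.mem_toList.mpr hg)
  have hJd : J ≤ Ideal.span {d} := by
    rw [← hG, Ideal.span_le]
    intro g hg
    exact Ideal.mem_span_singleton.mpr (hdvd g hg)
  have hdJ : d ∈ J := by
    refine hdiv d fun c b h => Ideal.mem_span_singleton.mpr (dvd_mul_foldr_gcd G.toList b c fun g hg => ?_)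
    exact Ideal.mem_span_singleton.mp (h g (hG ▸ Ideal.subset_span (Finset.mem_toList.mp hg)))
  exact ⟨d, le_antisymm hJd ((Ideal.span_singleton_le_iff_mem _).mpr hdJ)⟩

/-! ## §3 Divisoriality localises -/

/-- `Hom_A(I, A)` is finitely generated for an ideal `I` of a Noetherian ring (it embeds in `A^G` by evaluation at a finite generating set `G`).
[folklore] -/
theorem fg_top_linearMap {A : Type u} [CommRing A] [IsNoetherianRing A] (I : Ideal A) :
    (⊤ : Submodule A (I →ₗ[A] A)).FG := by
  classical
  obtain ⟨G, hG⟩ := (IsNoetherian.noetherian I : I.FG)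
  have hGI : ∀ g ∈ G, (g : A) ∈ I := fun g hg => hG ▸ Ideal.subset_span hg
  let ev : (I →ₗ[A] A) →ₗ[A] (G → A) :=
    { toFun := fun φ g => φ ⟨g, hGI g g.2⟩
      map_add' := fun φ ψ => rfl
      map_smul' := fun a φ => rfl }
  have hev : Function.Injective ev := by
    intro φ ψ h
    rw [← sub_eq_zero]
    apply LinearMap.ext
    intro y
    have hGK : (G : Set A) ⊆ Submodule.map I.subtype (LinearMap.ker (φ - ψ)) := by
      intro g hg
      refine ⟨⟨g, hGI g hg⟩, ?_, rfl⟩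
      rw [SetLike.mem_coe, LinearMap.mem_ker, LinearMap.sub_apply, sub_eq_zero]
      exact congr_fun h ⟨g, hg⟩
    have hK : I ≤ Submodule.map I.subtype (LinearMap.ker (φ - ψ)) := by
      have h1 := Submodule.span_le.mpr hGK
      rwa [hG] at h1
    obtain ⟨z, hz, hzy⟩ := hK y.2
    have : z = y := Subtype.ext hzy
    rw [← this]
    exact hz
  haveI : IsNoetherian A (I →ₗ[A] A) := isNoetherian_of_injective ev hev
  exact IsNoetherian.noetherian ⊤

/-- ★ **Divisoriality localises.** `A` a Noetherian domain, `I ≠ 0` a divisorial (v-) ideal, `M ⊆ A ∖ 0` multiplicative, `S = M⁻¹A`: `I S` is a nonzero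
divisorial ideal of `S`. [cite: Matsumura1987, §11] [folklore] -/
theorem divisorial_map_of_isLocalization {A : Type u} [CommRing A] [IsDomain A] [IsNoetherianRing A] (I : Ideal A) (hI0 : I ≠ ⊥)
    (hdiv : ∀ x : A, (∀ c b : A, (∀ y ∈ I, b * y ∈ Ideal.span ({c} : Set A)) → b * x ∈ Ideal.span ({c} : Set A)) → x ∈ I)
    (M : Submonoid A) (hM : M ≤ nonZeroDivisors A) (S : Type u) [CommRing S] [Algebra A S] [IsLocalization M S] :
    I.map (algebraMap A S) ≠ ⊥ ∧
      ∀ x' : S, (∀ c' b' : S, (∀ y' ∈ I.map (algebraMap A S), b' * y' ∈ Ideal.span ({c'} : Set S)) →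
        b' * x' ∈ Ideal.span ({c'} : Set S)) → x' ∈ I.map (algebraMap A S) := by
  classical
  have hinj : Function.Injective (algebraMap A S) := IsLocalization.injective S hM
  obtain ⟨y₀, hy₀I, hy₀⟩ := Submodule.exists_mem_ne_zero_of_ne_bot hI0
  refine ⟨fun h => ?_, fun x' hx' => ?_⟩
  · have h1 : algebraMap A S y₀ ∈ I.map (algebraMap A S) := Ideal.mem_map_of_mem _ hy₀I
    rw [h, Ideal.mem_bot] at h1
    exact hy₀ (hinj (by rw [h1, map_zero]))
  obtain ⟨⟨x, u⟩, hxu⟩ := IsLocalization.surj M x'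
  -- it suffices to find `v ∈ M` with `v x ∈ I`
  suffices h : ∃ v : M, (v : A) * x ∈ I by
    obtain ⟨v, hv⟩ := h
    have hu := IsLocalization.map_units S u
    have hvU := IsLocalization.map_units S v
    have e1 : x' = (↑hvU.unit⁻¹ * algebraMap A S ((v : A) * x)) * ↑hu.unit⁻¹ := by
      rw [map_mul, ← mul_assoc, IsUnit.val_inv_mul, one_mul, ← hxu, mul_assoc, IsUnit.mul_val_inv, mul_one]
    rw [e1]
    exact Ideal.mul_mem_right _ _ (Ideal.mul_mem_left _ _ (Ideal.mem_map_of_mem _ hv))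
  -- step 1: for every functional `φ`, some `v ∈ M` has `y₀ ∣ v·φ(y₀)·x`
  have step1 : ∀ φ : I →ₗ[A] A, ∃ v : M, y₀ ∣ (v : A) * (φ ⟨y₀, hy₀I⟩ * x) := by
    intro φ
    have htest := hx' (algebraMap A S y₀) (algebraMap A S (φ ⟨y₀, hy₀I⟩)) (by
      intro y' hy'
      have hle : I.map (algebraMap A S) ≤
          Submodule.comap (LinearMap.mulLeft S (algebraMap A S (φ ⟨y₀, hy₀I⟩))) (Ideal.span {algebraMap A S y₀}) := by
        rw [Ideal.map_le_iff_le_comap]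
        intro y hy
        change algebraMap A S (φ ⟨y₀, hy₀I⟩) * algebraMap A S y ∈ Ideal.span {algebraMap A S y₀}
        rw [← map_mul, Ideal.mem_span_singleton']
        refine ⟨algebraMap A S (φ ⟨y, hy⟩), ?_⟩
        rw [← map_mul, apply_mul_comm φ ⟨y, hy⟩ ⟨y₀, hy₀I⟩]
      exact hle hy')
    rw [Ideal.mem_span_singleton'] at htest
    obtain ⟨s', hs'⟩ := htest
    obtain ⟨⟨m, w⟩, hmw⟩ := IsLocalization.surj M s'
    refine ⟨w, ⟨m * u, hinj ?_⟩⟩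
    simp only [map_mul]
    linear_combination (-(algebraMap A S (w : A) * algebraMap A S (φ ⟨y₀, hy₀I⟩))) * hxu +
      (-(algebraMap A S (w : A) * algebraMap A S (u : A))) * hs' + (algebraMap A S y₀ * algebraMap A S (u : A)) * hmw
  -- step 2: one `V ∈ M` for all `φ` (finitely many generators)
  choose v hv using step1
  obtain ⟨F, hF⟩ := fg_top_linearMap I
  let V : M := ∏ φ ∈ F, v φ
  have hV : ∀ φ : I →ₗ[A] A, y₀ ∣ (V : A) * (φ ⟨y₀, hy₀I⟩ * x) := by
    let N : Submodule A (I →ₗ[A] A) :=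
      { carrier := {φ | y₀ ∣ (V : A) * (φ ⟨y₀, hy₀I⟩ * x)}
        add_mem' := fun {φ ψ} hφ hψ => by
          simp only [Set.mem_setOf_eq, LinearMap.add_apply, add_mul, mul_add] at hφ hψ ⊢
          exact dvd_add hφ hψ
        zero_mem' := by simp
        smul_mem' := fun a φ hφ => by
          simp only [Set.mem_setOf_eq, LinearMap.smul_apply, smul_eq_mul] at hφ ⊢
          have : (V : A) * (a * φ ⟨y₀, hy₀I⟩ * x) = a * ((V : A) * (φ ⟨y₀, hy₀I⟩ * x)) := by ring
          rw [this]
          exact hφ.mul_left a }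
    have hFN : (F : Set (I →ₗ[A] A)) ⊆ N := by
      intro φ hφ
      change y₀ ∣ (V : A) * (φ ⟨y₀, hy₀I⟩ * x)
      have hprod : (V : A) = (v φ : A) * ((∏ ψ ∈ F.erase φ, v ψ : M) : A) := by
        rw [← Submonoid.coe_mul, Finset.mul_prod_erase F v hφ]
      rw [hprod, mul_comm (v φ : A), mul_assoc]
      exact (hv φ).mul_left _
    have htop : (⊤ : Submodule A (I →ₗ[A] A)) ≤ N := by
      rw [← hF]
      exact Submodule.span_le.mpr hFN
    exact fun φ => htop Submodule.mem_top
  -- step 3: `V x ∈ I` by divisoriality of `I`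
  refine ⟨V, hdiv _ fun c b hbc => ?_⟩
  by_cases hc : c = 0
  · have h1 := hbc y₀ hy₀I
    rw [hc, Ideal.span_singleton_zero, Ideal.mem_bot] at h1
    have hb : b = 0 := (mul_eq_zero.mp h1).resolve_right hy₀
    rw [hb, zero_mul]
    exact Ideal.zero_mem _
  · have hex : ∀ y : I, ∃ a : A, a * c = b * y := fun y => Ideal.mem_span_singleton'.mp (hbc y y.2)
    choose f hf using hex
    have hfu : ∀ (y : I) (a : A), a * c = b * y → a = f y := fun y a ha =>
      mul_right_cancel₀ hc (ha.trans (hf y).symm)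
    let φ : I →ₗ[A] A :=
      { toFun := f
        map_add' := fun y z => (hfu (y + z) (f y + f z) (by rw [add_mul, hf, hf, Submodule.coe_add, mul_add])).symm
        map_smul' := fun a y => by
          simp only [RingHom.id_apply, smul_eq_mul]
          exact (hfu (a • y) (a * f y) (by rw [mul_assoc, hf, SetLike.val_smul, smul_eq_mul, mul_left_comm])).symm }
    obtain ⟨k, hk⟩ := hV φ
    have hk' : (V : A) * (f ⟨y₀, hy₀I⟩ * x) = y₀ * k := hk
    have hf0 := hf ⟨y₀, hy₀I⟩
    rw [Ideal.mem_span_singleton']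
    refine ⟨k, mul_left_cancel₀ hy₀ ?_⟩
    linear_combination ((V : A) * x) * hf0 + (-c) * hk'

/-! ## §4 Trace ideals of divisorial ideals on a regular punctured spectrum -/

/-- ★★ **`𝔪ⁿ ⊆ τ(I)` for nonzero divisorial `I` when the punctured spectrum is regular.** `A` a Noetherian local domain with `A_𝔮` regular for every prime
`𝔮 ≠ 𝔪`, `I` a nonzero divisorial ideal: `I A_𝔮` is divisorial (`divisorial_map_of_isLocalization`) in the UFD `A_𝔮` (Auslander–Buchsbaum), hence principal,
and `…TraceIdealPrimary.exists_pow_maximalIdeal_le_traceIdeal` applies. [cite: Matsumura1987, Thm. 20.3; §11] [folklore] -/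
theorem exists_pow_maximalIdeal_le_traceIdeal_of_divisorial {A : Type u} [CommRing A] [IsDomain A] [IsNoetherianRing A] [IsLocalRing A]
    (hreg : ∀ (𝔮 : Ideal A) [𝔮.IsPrime], 𝔮 ≠ maximalIdeal A → IsRegularLocalRing (Localization.AtPrime 𝔮))
    (I : Ideal A) (hI : I ≠ ⊥ ∧
      ∀ x : A, (∀ c b : A, (∀ y ∈ I, b * y ∈ Ideal.span ({c} : Set A)) → b * x ∈ Ideal.span ({c} : Set A)) → x ∈ I) :
    ∃ n : ℕ, maximalIdeal A ^ n ≤ (⨆ φ : I →ₗ[A] A, LinearMap.range φ : Ideal A) := by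
  refine TraceIdealPrimary.exists_pow_maximalIdeal_le_traceIdeal I hI.1 fun 𝔮 _ h𝔮 => ?_
  haveI : IsDomain (Localization.AtPrime 𝔮) :=
    IsLocalization.isDomain_localization (Ideal.primeCompl_le_nonZeroDivisors 𝔮)
  haveI : IsNoetherianRing (Localization.AtPrime 𝔮) :=
    IsLocalization.isNoetherianRing 𝔮.primeCompl (Localization.AtPrime 𝔮) inferInstance
  haveI : UniqueFactorizationMonoid (Localization.AtPrime 𝔮) :=
    Matsumura1987_20_3_holds (Localization.AtPrime 𝔮) (hreg 𝔮 h𝔮)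
  obtain ⟨-, hdiv'⟩ := divisorial_map_of_isLocalization I hI.1 hI.2 𝔮.primeCompl (Ideal.primeCompl_le_nonZeroDivisors 𝔮)
    (Localization.AtPrime 𝔮)
  exact exists_eq_span_singleton_of_divisorial _ (IsNoetherian.noetherian _) hdiv'

/-- ★★ **The `𝔪̂`-primary slot of the class-group centre.** `A` as above, `S` a finite family of nonzero divisorial ideals: `𝔪ᴺ ⊆ ∏_{T ∈ τ(S)} T`.
[cite: Matsumura1987, Thm. 20.3; §11] [folklore] -/
theorem exists_pow_maximalIdeal_le_prod_traceIdeal_of_divisorial {A : Type u} [CommRing A] [IsDomain A] [IsNoetherianRing A]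
    [IsLocalRing A]
    (hreg : ∀ (𝔮 : Ideal A) [𝔮.IsPrime], 𝔮 ≠ maximalIdeal A → IsRegularLocalRing (Localization.AtPrime 𝔮))
    (S : Finset (Ideal A)) (hS : ∀ I ∈ S, I ≠ ⊥ ∧
      ∀ x : A, (∀ c b : A, (∀ y ∈ I, b * y ∈ Ideal.span ({c} : Set A)) → b * x ∈ Ideal.span ({c} : Set A)) → x ∈ I) :
    ∃ N : ℕ, maximalIdeal A ^ N ≤
      ∏ T ∈ S.image (fun I : Ideal A => (⨆ φ : I →ₗ[A] A, LinearMap.range φ : Ideal A)), T := by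
  classical
  refine TraceIdealPrimary.exists_pow_le_prod (maximalIdeal A) _ fun T hT => ?_
  obtain ⟨I, hI, rfl⟩ := Finset.mem_image.mp hT
  exact exists_pow_maximalIdeal_le_traceIdeal_of_divisorial hreg I (hS I hI)

/-- **The `≠ ⊤` slot.** Over a local ring, if one member `I₀` of the finite family is not principal then `∏_{T ∈ τ(S)} T ≠ ⊤`. [folklore] -/
theorem prod_traceIdeal_ne_top_of_not_principal {A : Type u} [CommRing A] [IsLocalRing A] (S : Finset (Ideal A))
    {I₀ : Ideal A} (hI₀ : I₀ ∈ S) (hnp : ∀ x₀ ∈ I₀, I₀ ≠ Ideal.span {x₀}) :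
    (∏ T ∈ S.image (fun I : Ideal A => (⨆ φ : I →ₗ[A] A, LinearMap.range φ : Ideal A)), T) ≠ ⊤ := by
  classical
  exact TraceIdealPrimary.prod_ne_top_of_mem _ (Finset.mem_image_of_mem _ hI₀)
    (TraceIdealPrimary.traceIdeal_le_maximalIdeal_of_not_principal I₀ hnp).1

end Summit.ResolutionOfSingularities.ResolutionOfSingularities.Theorems.FRationalResolution.TraceIdealDivisorial
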